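import Summits.BirchSwinnertonDyer.Rank1Residual.Additive.InertialTorsionAdditive
import Summits.BirchSwinnertonDyer.Rank1Residual.GaloisImage.InertiaInvariantsFrobeniusKernel
import Literature.NumberTheory.GaloisRepresentations.IntegralGaloisActionProofs
import Literature.NumberTheory.GaloisRepresentations.RamificationFiltrationProofs
import Literature.NumberTheory.GaloisRepresentations.PadicAlgebraDegreeOnePlace
import Literature.NumberTheory.EllipticCurves.FullTwoTorsionConductorExponentProofs
import Literature.NumberTheory.EllipticCurves.CaiShuTian2014.HeegnerConditionProofs
import Literature.NumberTheory.EllipticCurves.NonEisensteinPrimeOfSurjective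
import HarnessLib

/-! # Line `bdpline`: Bertolini–Longo–Venerucci's Hypothesis 1.1 bullet 5 (`H⁰(I_{ℚ_q}, E[p]) = 0`
# for every `q ∣ N`) DISCHARGED at `p ≥ 5` on the all-additive cell (`ℓ² ∣ N` for every `ℓ ∣ N`)

Crux `AnticyclotomicEisensteinDivisibility` (stmt-BirchSwinnertonDyer-20727, route `SignedBaseChange`), line
`bdpline`, lead bsd-line-sbc-p1 gen 4. Companion of `…BdpLowerHalfAdditive.lean` (S1 on the all-additive cell
from the named fact `BertoliniLongoVenerucci2026.thmA_castellaWan_thm68_…`, whose binder is BLV's bullet 5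
VERBATIM). Here that binder becomes the CHECKABLE conductor condition "every prime of `N` divides `N` to the
second power", by kernel theorems only:

* §1 `geomPrimaryTorsion_eq_zero_of_absInertia_fixed_of_five_le` — at a place `v ∤ p` of ADDITIVE reduction of
  an elliptic curve over a number field, with `p ≥ 5`, every point of `E[p^∞](K̄)` fixed by the local inertia
  group `absInertia K_v` (through `res : Γ_{K_v} → Γ_K`) is `0`: Kodaira–Néron over `K_v^nr`
  (`[E(K_v^nr) : E₀(K_v^nr)] ≤ 4`, tree `exists_nsmul_reducesToNonsingular_le_four_of_hasAdditiveReduction`,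
  Silverman *AEC* VII.6.1) and Serre–Tate's argument on torsion points (tree
  `Additive.nsmul_eq_zero_of_absInertia_fixed_of_exponent`, *ATAEC* IV.10.2(a)) give `c • Q = 0` with
  `0 < c ≤ 4 < p`, so the `p`-power order of `Q` is `1`. (At `p = 3` the statement fails: Kodaira IV/IV*.)
* §2 `geomPrimaryTorsion_eq_zero_of_inertia_fixed_of_mem_primesAbove` — the same for the GLOBAL inertia group
  `I_𝔓 ≤ Γ_K` of ANY prime `𝔓 ∣ v` of `ℤ̄_K` (all `𝔓 ∣ v` are conjugate,
  `exists_smul_eq_of_mem_primesAbove_holds`; `I_{τ•𝔓} = τ I_𝔓 τ⁻¹`, `Ideal.inertia_smul`; `I_{𝔓₀} = res I_{K_v}`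
  for the prime of the chosen embedding, `InertiaDivisible.forall_inertia_adicCompletionPrime_smul_eq_iff`).
* §3 `blvBulletFive_of_forall_sq_dvd` — over `ℚ`: if `W` is elliptic with good reduction at `p ≥ 5` and every
  prime `ℓ ∣ N_E` has `ℓ² ∣ N_E`, then for every prime `q ∣ N_E`, every place `v ∋ q` of `𝓞 ℚ`, every prime
  `𝔓 ∣ v` of `ℤ̄` and every `P ∈ E[p]` fixed by `I_𝔓`: `P = 0` — BLV Hyp. 1.1 bullet 5 in the Lean currency of
  `BertoliniLongoVenerucci2026.DefiniteGrossPeriodSelmer` / `…IndefiniteMainConjectureSupersingularBDP`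
  (`ℓ² ∣ N` ⟹ neither good nor multiplicative at `ℓ` — `not_dvd_conductorNorm_of_hasGoodReductionAtPrime`,
  `factorization_conductorNorm_eq_one_of_hasMultiplicativeReductionAtPrime` — ⟹ additive at the place of `𝓞 ℚ`
  over `ℓ`, `hasAdditiveReductionAt_ringOfIntegers_of_additive`).

The S1-shaped corollary with the checkable binders (`¬ p ∣ h_K`, `∀ ℓ ∣ N, ℓ² ∣ N`) lives in the sibling
`…BdpLowerHalfAllAdditive.lean` (which imports the route file through S1's text); THIS file is route-independent.

No summit statement is proved here; BSD / the crux are NOT proved by this file.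
-/

-- D-0017: single-problem summit, the namespace repeats the problem name by design.
set_option linter.dupNamespace false
set_option autoImplicit false

noncomputable section

open scoped Classical NNReal NumberField Pointwise

open NumberField IsDedekindDomain Field IsDedekindDomain.HeightOneSpectrum
  Literature.NumberTheory.EllipticCurves Literature.NumberTheory.GaloisRepresentations
  Literature.NumberTheory.GaloisRepresentations.IsNonarchimedeanLocalField
  Summit.BirchSwinnertonDyer.Rank1Residual

namespace Summit.BirchSwinnertonDyer.BirchSwinnertonDyer.Theorems.SignedBaseChangeAcDivAdditiveCell

/-! ## §1 `E[p^∞]^{I_v} = 0` at an additive `v ∤ p`, `p ≥ 5` (local inertia) -/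

section Local

variable {K : Type} [Field K] [NumberField K] (W : WeierstrassCurve K) [W.IsElliptic] (p : ℕ)
  [hp : Fact p.Prime] (v : HeightOneSpectrum (𝓞 K))

/-- **`E(K_v^nr)[p^∞] = 0` at an additive place `v ∤ p` when `p ≥ 5`.** Every point `Q ∈ E[p^∞](K̄)` fixed
by the local inertia group `absInertia K_v` (acting through `res : Γ_{K_v} → Γ_K`) is `0`: Kodaira–Néron
gives `c • Q = 0` with `0 < c ≤ 4` (tree `exists_nsmul_reducesToNonsingular_le_four_of_hasAdditiveReduction`
+ `Additive.nsmul_eq_zero_of_absInertia_fixed_of_exponent`), and the order of `Q`, a power of `p ≥ 5`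
dividing `c ≤ 4`, is `1`. [cite: SilvermanAEC2009, Thm. VII.6.1 (PDF p. 177)]
[cite: SilvermanATAEC1994, Thm. IV.10.2(a), additive case, and its proof (PDF pp. 358–359)] -/
theorem geomPrimaryTorsion_eq_zero_of_absInertia_fixed_of_five_le
    (hpv : ((p : ℕ) : 𝓞 K) ∉ v.asIdeal) (hp5 : 5 ≤ p) (hadd : W.HasAdditiveReductionAt v)
    (Q : W.geomPrimaryTorsion p)
    (hQ : ∀ τ ∈ absInertia (v.adicCompletion K),
      absGaloisRestrict K (v.adicCompletion K) τ • Q = Q) :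
    Q = 0 := by
  obtain ⟨w, hw⟩ := v.exists_spectralValuation
  obtain ⟨𝔐, h𝔐⟩ := v.localPrimesAbove_nonempty
  haveI : (W.localMinimalModel v).IsElliptic := W.isElliptic_localMinimalModel v
  haveI : (W.localMinimalModel v).HasAdditiveReduction (v.adicCompletionIntegers K) := hadd
  obtain ⟨c, hc0, hc4, hcE₀⟩ :=
    (W.localMinimalModel v).exists_nsmul_reducesToNonsingular_le_four_of_hasAdditiveReduction w hw h𝔐
  have hcQ : c • Q = 0 :=
    Additive.nsmul_eq_zero_of_absInertia_fixed_of_exponent W p v hpv hadd hw h𝔐 hcE₀ Q hQ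
  obtain ⟨m, hm⟩ : ∃ m : ℕ, p ^ m • Q = 0 := by
    obtain ⟨m, hm⟩ := (AddCommGroup.mem_primaryComponent).mp Q.2
    exact ⟨m, Subtype.ext (by rw [AddSubgroupClass.coe_nsmul, hm, ZeroMemClass.coe_zero])⟩
  -- the order of `Q` divides `gcd(c, p^m) = 1`
  have hprime : p.Prime := hp.out
  have hoc : addOrderOf Q ∣ c := addOrderOf_dvd_of_nsmul_eq_zero hcQ
  have hom : addOrderOf Q ∣ p ^ m := addOrderOf_dvd_of_nsmul_eq_zero hm
  obtain ⟨j, -, hoj⟩ := (Nat.dvd_prime_pow hprime).mp hom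
  have hj0 : j = 0 := by
    by_contra hj
    have hpc : p ∣ c := (dvd_pow_self p hj).trans (hoj ▸ hoc)
    have := Nat.le_of_dvd hc0 hpc
    omega
  rw [hj0, pow_zero] at hoj
  exact AddMonoid.addOrderOf_eq_one_iff.mp hoj

/-! ## §2 The same for the global inertia group of ANY prime `𝔓 ∣ v` of `ℤ̄_K` -/

/-- **`E[p^∞]^{I_𝔓} = 0` for every prime `𝔓 ∣ v` of `ℤ̄_K`**, at an additive `v ∤ p` with `p ≥ 5`: all primes
above `v` are `Γ_K`-conjugate (`exists_smul_eq_of_mem_primesAbove_holds`), `I_{τ • 𝔓₀} = τ I_{𝔓₀} τ⁻¹`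
(`Ideal.inertia_smul`), and for the prime `𝔓₀` of the chosen embedding `I_{𝔓₀} = res (I_{K_v})`
(`InertiaDivisible.forall_inertia_adicCompletionPrime_smul_eq_iff`), so §1 applies to `τ⁻¹ • Q`.
[cite: NeukirchANT1999, Ch. I §9 Prop. (9.1) and Ch. II §9 Prop. (9.6)] [cite: SilvermanAEC2009, Thm. VII.6.1] -/
theorem geomPrimaryTorsion_eq_zero_of_inertia_fixed_of_mem_primesAbove
    (hpv : ((p : ℕ) : 𝓞 K) ∉ v.asIdeal) (hp5 : 5 ≤ p) (hadd : W.HasAdditiveReductionAt v)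
    {𝔓 : Ideal (absIntegers (𝓞 K) K)} (h𝔓 : 𝔓 ∈ v.primesAbove) (Q : W.geomPrimaryTorsion p)
    (hQ : ∀ σ ∈ 𝔓.inertia (absoluteGaloisGroup K), σ • Q = Q) :
    Q = 0 := by
  obtain ⟨τ, hτ⟩ := exists_smul_eq_of_mem_primesAbove_holds (adicCompletionPrime_mem_primesAbove K v) h𝔓
  -- `τ⁻¹ • Q` is fixed by `I_{𝔓₀}`
  have hfix : ∀ i ∈ (adicCompletionPrime K v).inertia (absoluteGaloisGroup K), i • (τ⁻¹ • Q) = τ⁻¹ • Q := by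
    intro i hi
    have hi' : τ * i * τ⁻¹ ∈ 𝔓.inertia (absoluteGaloisGroup K) := by
      rw [← hτ, Ideal.inertia_smul, Subgroup.mem_pointwise_smul_iff_inv_smul_mem]
      simpa [MulAut.smul_def, mul_assoc] using hi
    have h := hQ _ hi'
    calc i • τ⁻¹ • Q = τ⁻¹ • ((τ * i * τ⁻¹) • Q) := by
          rw [mul_smul, mul_smul, inv_smul_smul]
      _ = τ⁻¹ • Q := by rw [h]
  have h0 : τ⁻¹ • Q = 0 :=
    geomPrimaryTorsion_eq_zero_of_absInertia_fixed_of_five_le W p v hpv hp5 hadd (τ⁻¹ • Q)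
      ((GaloisImage.InertiaDivisible.forall_inertia_adicCompletionPrime_smul_eq_iff W p v (τ⁻¹ • Q)).mp hfix)
  have : Q = τ • (τ⁻¹ • Q) := (smul_inv_smul τ Q).symm
  rw [this, h0, smul_zero]

/-- **The `E[p]`-version** (`geomTorsion W p ⊆ E[p^∞]`): at an additive `v ∤ p` with `p ≥ 5`, every
`P ∈ E[p](K̄)` fixed by `I_𝔓` (`𝔓 ∣ v` any prime of `ℤ̄_K`) is `0`. [cite: SilvermanAEC2009, Thm. VII.6.1] -/
theorem geomTorsion_eq_zero_of_inertia_fixed_of_mem_primesAbove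
    (hpv : ((p : ℕ) : 𝓞 K) ∉ v.asIdeal) (hp5 : 5 ≤ p) (hadd : W.HasAdditiveReductionAt v)
    {𝔓 : Ideal (absIntegers (𝓞 K) K)} (h𝔓 : 𝔓 ∈ v.primesAbove) (P : W.geomTorsion (p : ℤ))
    (hP : ∀ σ ∈ 𝔓.inertia (absoluteGaloisGroup K), σ • P = P) :
    P = 0 := by
  have hmem : (P : W.geomPoints) ∈ W.geomPrimaryTorsion p := by
    refine (AddCommGroup.mem_primaryComponent).mpr ⟨1, ?_⟩
    have h := (WeierstrassCurve.mem_geomTorsion_iff W (p : ℤ) (P : W.geomPoints)).mp P.2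
    rw [pow_one, ← natCast_zsmul]
    exact h
  set Q : W.geomPrimaryTorsion p := ⟨P, hmem⟩ with hQdef
  have hQ : ∀ σ ∈ 𝔓.inertia (absoluteGaloisGroup K), σ • Q = Q := fun σ hσ ↦
    Subtype.ext (by
      rw [primaryComponent.coe_smul]
      have h := congrArg (fun R : W.geomTorsion (p : ℤ) ↦ (R : W.geomPoints)) (hP σ hσ)
      simpa [AddSubgroup.torsionBy.coe_smul] using h)
  have h0 := geomPrimaryTorsion_eq_zero_of_inertia_fixed_of_mem_primesAbove W p v hpv hp5 hadd h𝔓 Q hQ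
  exact Subtype.ext (congrArg (fun R : W.geomPrimaryTorsion p ↦ (R : W.geomPoints)) h0)

end Local

/-! ## §3 Over `ℚ`: BLV Hyp. 1.1 bullet 5 from "`ℓ² ∣ N` for every `ℓ ∣ N`" at `p ≥ 5` -/

section Rat

variable (W : WeierstrassCurve ℚ) [W.IsElliptic] (p : ℕ) [hp : Fact p.Prime]

/-- **The all-additive cell satisfies Bertolini–Longo–Venerucci's Hypothesis 1.1 bullet 5 at `p ≥ 5`.** If
`W/ℚ` has good reduction at `p ≥ 5` and every prime `ℓ ∣ N_E` satisfies `ℓ² ∣ N_E` (every bad prime is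
ADDITIVE: `f_ℓ ≥ 2`), then for every prime `q ∣ N_E`, every place `v ∋ q` of `𝓞 ℚ`, every prime `𝔓 ∣ v` of
`ℤ̄` and every `P ∈ E[p]` fixed by the inertia group `I_𝔓`: `P = 0`. (`ℓ² ∣ N` excludes good and
multiplicative reduction at `ℓ` by `not_dvd_conductorNorm_of_hasGoodReductionAtPrime` and
`factorization_conductorNorm_eq_one_of_hasMultiplicativeReductionAtPrime`; then §2 at the place of `𝓞 ℚ` over
`ℓ`, which is additive by `hasAdditiveReductionAt_ringOfIntegers_of_additive`.)
[cite: BertoliniLongoVenerucci2026, Hyp. 1.1 bullet 5 (arXiv:2306.17784 p0003 L17–L18)]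
[cite: SilvermanATAEC1994, Thm. IV.10.2 (PDF pp. 358–359)] [cite: SilvermanAEC2009, Thm. VII.6.1] -/
theorem blvBulletFive_of_forall_sq_dvd (hp5 : 5 ≤ p) (hgood : W.HasGoodReductionAtPrime p) {N : ℕ}
    (hN : (N : ℤ) = W.conductorNorm ℤ) (hsq : ∀ ℓ : ℕ, ℓ.Prime → ℓ ∣ N → ℓ ^ 2 ∣ N) :
    ∀ q : ℕ, q.Prime → q ∣ N → ∀ v : HeightOneSpectrum (𝓞 ℚ), ((q : ℕ) : 𝓞 ℚ) ∈ v.asIdeal →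
      ∀ 𝔓 ∈ v.primesAbove, ∀ P : W.geomTorsion (p : ℤ),
        (∀ σ ∈ 𝔓.inertia (absoluteGaloisGroup ℚ), σ • P = P) → P = 0 := by
  intro q hq hqN v hqv 𝔓 h𝔓 P hP
  haveI hqF : Fact q.Prime := ⟨hq⟩
  have hN' : W.conductorNorm ℤ = N := by exact_mod_cast hN.symm
  have hN0 : W.conductorNorm ℤ ≠ 0 := (W.conductorNorm_pos_holds).ne'
  -- `q` is a bad prime, neither good nor multiplicative
  have hq2 : q ^ 2 ∣ W.conductorNorm ℤ := hN' ▸ hsq q hq hqN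
  have hng : ¬ W.HasGoodReductionAtPrime q := fun h ↦
    not_dvd_conductorNorm_of_hasGoodReductionAtPrime W h (hN' ▸ hqN)
  have hnm : ¬ W.HasMultiplicativeReductionAtPrime q := fun h ↦ by
    have h1 := W.factorization_conductorNorm_eq_one_of_hasMultiplicativeReductionAtPrime q h
    have h2 := (hq.pow_dvd_iff_le_factorization hN0).mp hq2
    omega
  -- `v` is the place of `𝓞 ℚ` over `q`, additive
  have hveq : v = (Rat.HeightOneSpectrum.primesEquiv (R := 𝓞 ℚ)).symm ⟨q, hq⟩ := by
    apply (Rat.HeightOneSpectrum.primesEquiv (R := 𝓞 ℚ)).injective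
    rw [Equiv.apply_symm_apply]
    exact Subtype.ext (LocalField.primesEquiv_eq_of_natCast_mem q v hqv)
  have hadd : W.HasAdditiveReductionAt v := by
    rw [hveq]
    exact hasAdditiveReductionAt_ringOfIntegers_of_additive W q hng hnm
  -- `q ≠ p` since `p` is good, so `v ∤ p`
  have hqp : q ≠ p := by
    rintro rfl
    exact hng hgood
  have hpv : ((p : ℕ) : 𝓞 ℚ) ∉ v.asIdeal := by
    intro hpv
    have h1 := LocalField.primesEquiv_eq_of_natCast_mem p v hpv
    have h2 := LocalField.primesEquiv_eq_of_natCast_mem q v hqv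
    exact hqp (h2.symm.trans h1)
  exact geomTorsion_eq_zero_of_inertia_fixed_of_mem_primesAbove W p v hpv hp5 hadd h𝔓 P hP

end Rat

end Summit.BirchSwinnertonDyer.BirchSwinnertonDyer.Theorems.SignedBaseChangeAcDivAdditiveCell

end
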